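import Literature.Analysis.FluidPDE.StatisticalSolutionEnergyEq
import Literature.Analysis.FunctionSpaces.TorusSpectralWeakDerivative
import Literature.Analysis.FunctionSpaces.TorusLadyzhenskaya
import HarnessLib

/-!
# Ladyzhenskaya's inequality for `L²` fields with finite spectral dissipation on `UnitAddTorus (Fin 2)`

Analysis/FluidPDE support file for the discharge of the two-dimensional uniqueness theorem of
Leray–Hopf weak solutions, `Literature.Analysis.FluidPDE.lions_prodi_uniqueness_torus2`
(Foias–Manley–Rosa–Temam 2001, Ch. II Thm. 7.3; the trilinear term is controlled by "the
Ladyzhenskaya inequality `‖u‖²_{L⁴} ≤ c|u|‖u‖`", op. cit. App. II.A (A.47)). The tree's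
`Torus.exists_ladyzhenskaya_const` (`FunctionSpaces/TorusLadyzhenskaya`) states the inequality
for *smooth* fields with classical partial derivatives; Leray–Hopf solutions on the torus are
only in the spectral class `L²(0,T; H¹)` (`Torus.MemL2Sobolev`, dissipation `Torus.eGradNormSq`).
This file transfers the inequality to that class:

* `Torus.sum_lintegral_enorm_sq_partialDeriv_eq_eGradNormSq` — for smooth `w`,
  `∑ⱼ ∫ ‖∂ⱼw‖² = eGradNormSq w` (Parseval for `𝓕(∂ⱼw)(k) = 2πi kⱼ ŵ(k)`, through the tree's
  `Torus.lintegral_sum_enorm_sq_eq_eGradNormSq`);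
* `exists_ladyzhenskaya_const_memLp` — **`∫ ‖v‖⁴ ≤ C (∫ ‖v‖²)(∫ ‖v‖² + eGradNormSq v)` for every
  `v ∈ L²(UnitAddTorus (Fin 2); ℝ²)`** (lower integrals; the smooth inequality for the truncations `P_N v`, whose
  dissipation is at most that of `v`, Bessel, and Fatou along an a.e.-convergent subsequence);
* `tendsto_lintegral_enorm_pow_four_fourierTruncate_sub` — **`P_N v → v` in `L⁴`** when
  `eGradNormSq v < ∞` (the inequality for `P_N v - v`).

## References

* O. A. Ladyzhenskaya, Comm. Pure Appl. Math. 12 (1959), 427–433, Lemma 1.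
* C. Foias, O. Manley, R. Rosa, R. Temam, *Navier–Stokes Equations and Turbulence*, CUP 2001,
  Ch. II Thm. 7.3, App. II.A (A.47).
-/

open MeasureTheory Set Filter Topology UnitAddTorus
open scoped ENNReal NNReal InnerProductSpace

noncomputable section

namespace Literature.Analysis.FluidPDE

open FunctionSpaces

variable {d : Type*} [Fintype d] [DecidableEq d]

/-! ### The spectral dissipation of a smooth field is the `L²` mass of its gradient -/

omit [DecidableEq d] in
/-- Components of the complexified Fourier coefficient are the coefficients of the components. [folklore] -/
theorem Torus.mFourierCoeff_component (a : UnitAddTorus d → EuclideanSpace ℝ d) (ha : Integrable a volume)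
    (i : d) (k : d → ℤ) :
    mFourierCoeff (fun x => ((a x i : ℝ) : ℂ)) k = mFourierCoeff (EuclideanSpace.complexify ∘ a) k i := by
  rw [Torus.mFourierCoeff_complexify_apply ha]

/-- **`∑ⱼ ∫ ‖∂ⱼw‖² = eGradNormSq w` for smooth fields** (Parseval for the classical partial
derivatives, `𝓕(∂ⱼw)(k) = 2πi kⱼ ŵ(k)`; Grafakos 2014, Prop. 3.2.6 (8), 3.2.7 (3)). [folklore] -/
theorem Torus.sum_lintegral_enorm_sq_partialDeriv_eq_eGradNormSq {w : UnitAddTorus d → EuclideanSpace ℝ d}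
    (hw : Torus.IsSmooth w) :
    ∑ j, ∫⁻ x, ‖Torus.partialDeriv j w x‖ₑ ^ 2 = Torus.eGradNormSq w := by
  have hwi : Integrable w volume := hw.integrable
  set g : d → d → UnitAddTorus d → ℂ := fun i j x => ((Torus.partialDeriv j w x i : ℝ) : ℂ) with hg
  have hgm : ∀ i j, MemLp (g i j) 2 volume := fun i j => by
    have h1 : MemLp (Torus.partialDeriv j w) 2 volume := (hw.partialDeriv j).memLp 2
    exact Torus.memLp_ofReal_apply h1 i
  have hcoeff : ∀ i j (k : d → ℤ), mFourierCoeff (g i j) k =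
      (2 * Real.pi * Complex.I * (k j) : ℂ) * mFourierCoeff (fun x => (w x i : ℂ)) k := by
    intro i j k
    rw [hg]
    dsimp only
    rw [Torus.mFourierCoeff_component _ (hw.partialDeriv j).integrable, Torus.mFourierCoeff_complexify_partialDeriv hw,
      PiLp.smul_apply, smul_eq_mul, Torus.mFourierCoeff_component _ hwi]
  rw [← Torus.lintegral_sum_enorm_sq_eq_eGradNormSq (hw.memLp 2) hgm hcoeff]
  rw [← lintegral_finsetSum' _ fun j _ => (((hw.partialDeriv j).continuous.enorm.measurable.pow_const 2).aemeasurable)]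
  refine lintegral_congr fun x => ?_
  rw [Finset.sum_comm]
  refine Finset.sum_congr rfl fun j _ => ?_
  rw [hg]
  dsimp only
  rw [← ofReal_norm, ← ENNReal.ofReal_pow (norm_nonneg _), EuclideanSpace.norm_sq_eq,
    ENNReal.ofReal_sum_of_nonneg fun i _ => sq_nonneg _]
  refine Finset.sum_congr rfl fun i _ => ?_
  rw [← ofReal_norm, ← ENNReal.ofReal_pow (norm_nonneg _), Complex.norm_real]

/-! ### Ladyzhenskaya's inequality for spectrally `H¹` fields on `UnitAddTorus (Fin 2)` -/

/-- Bessel for the truncation, lower-integral form: `∫⁻ ‖P_N v‖ₑ² ≤ ∫⁻ ‖v‖ₑ²`. [folklore] -/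
theorem Torus.lintegral_enorm_sq_fourierTruncate_le {v : UnitAddTorus d → EuclideanSpace ℝ d}
    (hv : MemLp v 2 volume) (N : ℕ) :
    ∫⁻ x, ‖Torus.fourierTruncate N v x‖ₑ ^ 2 ≤ ∫⁻ x, ‖v x‖ₑ ^ 2 := by
  rw [← Torus.tsum_enorm_sq_mFourierCoeff_complexify (Torus.memLp_fourierTruncate N v 2),
    ← Torus.tsum_enorm_sq_mFourierCoeff_complexify hv]
  refine ENNReal.tsum_le_tsum fun k => ?_
  rw [Torus.mFourierCoeff_fourierTruncate (hv.integrable one_le_two)]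
  split_ifs
  · exact le_rfl
  · simp

/-- **Ladyzhenskaya's inequality for `L²` fields with finite spectral dissipation on `UnitAddTorus (Fin 2)`**
(Ladyzhenskaya 1959; FMRT 2001, App. II.A (A.47), `‖u‖²_{L⁴} ≤ c|u| ‖u‖`): with the constant of
`Torus.exists_ladyzhenskaya_const`, for every `v ∈ L²(UnitAddTorus (Fin 2); ℝ²)`,
`∫⁻ ‖v‖ₑ⁴ ≤ C (∫⁻ ‖v‖ₑ²)((∫⁻ ‖v‖ₑ²) + eGradNormSq v)` (both sides may be `∞`). Proof: the smooth
inequality for the truncations `P_N v` (`∑ⱼ ∫ ‖∂ⱼP_Nv‖² = eGradNormSq (P_N v) ≤ eGradNormSq v`,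
Bessel), and Fatou along a subsequence with `P_N v → v` a.e. [cite: FoiasManleyRosaTemam2001, App. II.A (A.47)] -/
theorem exists_ladyzhenskaya_const_memLp : ∃ C : ℝ≥0∞, C ≠ ⊤ ∧ ∀ (v : UnitAddTorus (Fin 2) → (EuclideanSpace ℝ (Fin 2))), MemLp v 2 volume →
    ∫⁻ x, ‖v x‖ₑ ^ 4 ≤ C * ((∫⁻ x, ‖v x‖ₑ ^ 2) * ((∫⁻ x, ‖v x‖ₑ ^ 2) + Torus.eGradNormSq v)) := by
  obtain ⟨C, hC, hLad⟩ := Torus.exists_ladyzhenskaya_const (EuclideanSpace ℝ (Fin 2))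
  refine ⟨C, hC, fun v hv => ?_⟩
  have hvi : Integrable v volume := hv.integrable one_le_two
  set R : ℝ≥0∞ := C * ((∫⁻ x, ‖v x‖ₑ ^ 2) * ((∫⁻ x, ‖v x‖ₑ ^ 2) + Torus.eGradNormSq v)) with hR
  -- the bound for every truncation
  have hN : ∀ N : ℕ, ∫⁻ x, ‖Torus.fourierTruncate N v x‖ₑ ^ 4 ≤ R := by
    intro N
    have hs : Torus.IsSmooth (Torus.fourierTruncate N v) := Torus.isSmooth_fourierTruncate N v
    refine (hLad _ hs).trans ?_
    rw [Torus.sum_lintegral_enorm_sq_partialDeriv_eq_eGradNormSq hs, hR]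
    have h1 := Torus.lintegral_enorm_sq_fourierTruncate_le hv N
    have h2 := Torus.eGradNormSq_fourierTruncate_le hvi N
    gcongr
  -- a subsequence converging a.e.
  have hL2 : Tendsto (fun N => eLpNorm (Torus.fourierTruncate N v - v) 2 volume) atTop (𝓝 0) :=
    Torus.tendsto_eLpNorm_fourierTruncate_sub hv
  have hmeas : ∀ N, AEStronglyMeasurable (Torus.fourierTruncate N v) volume := fun N =>
    (Torus.isSmooth_fourierTruncate N v).continuous.aestronglyMeasurable
  have hinm : TendstoInMeasure volume (fun N => Torus.fourierTruncate N v) atTop v :=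
    tendstoInMeasure_of_tendsto_eLpNorm (by norm_num) hmeas hv.1 hL2
  obtain ⟨ns, hns, hae⟩ := hinm.exists_seq_tendsto_ae
  -- Fatou
  have hlim : ∀ᵐ x ∂volume, Tendsto (fun j => ‖Torus.fourierTruncate (ns j) v x‖ₑ ^ 4) atTop (𝓝 (‖v x‖ₑ ^ 4)) := by
    filter_upwards [hae] with x hx
    exact ((ENNReal.continuous_pow 4).comp continuous_enorm).continuousAt.tendsto.comp hx
  calc ∫⁻ x, ‖v x‖ₑ ^ 4 = ∫⁻ x, liminf (fun j => ‖Torus.fourierTruncate (ns j) v x‖ₑ ^ 4) atTop := by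
        refine lintegral_congr_ae ?_
        filter_upwards [hlim] with x hx
        exact hx.liminf_eq.symm
    _ ≤ liminf (fun j => ∫⁻ x, ‖Torus.fourierTruncate (ns j) v x‖ₑ ^ 4) atTop :=
        lintegral_liminf_le' fun j => ((hmeas (ns j)).enorm.pow_const 4)
    _ ≤ R := liminf_le_of_frequently_le' (Frequently.of_forall fun j => hN (ns j))

/-- **`L⁴` convergence of the truncations** of an `L²` field with finite spectral dissipation:
`∫⁻ ‖P_N v - v‖ₑ⁴ → 0` (Ladyzhenskaya for `P_N v - v`, whose dissipation is at most that of `v`). [folklore] -/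
theorem tendsto_lintegral_enorm_pow_four_fourierTruncate_sub {v : UnitAddTorus (Fin 2) → (EuclideanSpace ℝ (Fin 2))} (hv : MemLp v 2 volume)
    (hgrad : Torus.eGradNormSq v ≠ ⊤) :
    Tendsto (fun N => ∫⁻ x, ‖Torus.fourierTruncate N v x - v x‖ₑ ^ 4) atTop (𝓝 0) := by
  obtain ⟨C, hC, hLad⟩ := exists_ladyzhenskaya_const_memLp
  have hvi : Integrable v volume := hv.integrable one_le_two
  -- dissipation of the tail is at most that of `v`
  have htail : ∀ N, Torus.eGradNormSq (Torus.fourierTruncate N v - v) ≤ Torus.eGradNormSq v := by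
    intro N
    rw [Torus.eGradNormSq_eq_tsum, Torus.eGradNormSq_eq_tsum]
    refine mul_le_mul_right (ENNReal.tsum_le_tsum fun k => ?_) _
    rw [Torus.mFourierCoeff_fourierTruncate_sub hvi]
    split_ifs
    · simp
    · rw [enorm_neg]
  -- `L²` convergence in lower-integral form
  have hL2 : Tendsto (fun N => ∫⁻ x, ‖Torus.fourierTruncate N v x - v x‖ₑ ^ 2) atTop (𝓝 0) :=
    Torus.tendsto_lintegral_enorm_sq_fourierTruncate_sub hv
  have hbound : ∀ N, ∫⁻ x, ‖Torus.fourierTruncate N v x - v x‖ₑ ^ 4 ≤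
      C * ((∫⁻ x, ‖Torus.fourierTruncate N v x - v x‖ₑ ^ 2) *
        ((∫⁻ x, ‖Torus.fourierTruncate N v x - v x‖ₑ ^ 2) + Torus.eGradNormSq v)) := by
    intro N
    have h := hLad (Torus.fourierTruncate N v - v) ((Torus.memLp_fourierTruncate N v 2).sub hv)
    simp only [Pi.sub_apply] at h
    refine h.trans ?_
    have := htail N
    gcongr
  have hlim : Tendsto (fun N => C * ((∫⁻ x, ‖Torus.fourierTruncate N v x - v x‖ₑ ^ 2) *
      ((∫⁻ x, ‖Torus.fourierTruncate N v x - v x‖ₑ ^ 2) + Torus.eGradNormSq v))) atTop (𝓝 0) := by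
    have h1 : Tendsto (fun N => (∫⁻ x, ‖Torus.fourierTruncate N v x - v x‖ₑ ^ 2) *
        ((∫⁻ x, ‖Torus.fourierTruncate N v x - v x‖ₑ ^ 2) + Torus.eGradNormSq v)) atTop (𝓝 0) := by
      have h := ENNReal.Tendsto.mul hL2 (Or.inr (by simpa using hgrad)) (hL2.add tendsto_const_nhds)
        (Or.inr (by simp))
      simpa using h
    have h := ENNReal.Tendsto.const_mul h1 (Or.inr hC)
    simpa using h
  exact tendsto_of_tendsto_of_tendsto_of_le_of_le' tendsto_const_nhds hlim (Eventually.of_forall fun N => bot_le)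
    (Eventually.of_forall hbound)

end Literature.Analysis.FluidPDE

end
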